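import Mathlib
import HarnessLib
import HarnessLib.Audit
import Summits.MatrixMultiplication.Statement
import Literature.Computability.AlgebraicComplexity.AsymptoticSpectrum
import Literature.Computability.AlgebraicComplexity.GroupAlgebraTensor
import HarnessLib.Audit.Status.Attr

/-!
Route: NilpotentLieHosts

DORMANT since 2026-08-24T07:49:38Z (reconciler: no traction for 6.6 d (last activity item-evidence-added at 2026-08-17T16:51:17Z); parked, not closed — `ledger route dormant route-MatrixMultiplication-NilpotentLieHosts --off` to reactiv) — unstaffed, not closed; items shared with open routes are served there. `ledger route dormant <id> --off` reactivates.

# Route NilpotentLieHosts — nilpotent Lie hosts for BCGPU priced by truncated enveloping algebras,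
threshold at half dimension

It suffices to show X = COST ∧ DESIGN in the unitriangular tower U_d(ℤ) ⊂ SL(d,ℤ), d ≥ 3 (d = 3 is
the Heisenberg group H_3; entries
x_ij carry the lower-central-series weight j − i): DESIGN — for some d ≥ 3 and every δ > 0,
arbitrarily large degree budgets s admit
finite X, Y, Z ⊂ U_d(ℤ) with the triple product property (x y⁻¹ y' z⁻¹ = x' z'⁻¹ ⇒ x = x', y = y', z
= z') and BCGPU separating
polynomials (BlasiakCohnGrochowPrattUmans2024 Def 2.1: weighted degree ≤ s, = 1 at x₀ z₀⁻¹, = 0 on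
the rest of X Y⁻¹ Y Z⁻¹) of total
size |X||Y||Z| ≥ s^((3/2)·D − δ), D = d(d−1)/2 — half (topological) dimension, the absolute ceiling;
COST — every such design is priced
by the truncated enveloping algebra U(u_d)/I^(s+1) in the finite-Heisenberg numerology:
(|X||Y||Z|)^(ω/3) ≤ C_d (s+1)^(((D−b)/2)·ω + b) for
some b > 0 (d = 3: b = 1, exponent ω + 1 — card (1a), re-derived by the planner, filed as crux 3
until it lands; d ≥ 4: conjectured with b = ⌊d/2⌋). Realises card
heisenberg-lie-enveloping-hosts (spine): its (1a) = HeisenbergEnvelopingCost, C1 =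
HigherStepThresholdDesigns, C2 = UnitriangularCostShape,
C3 (no-go) sharpened to HeisenbergThresholdObstruction; the Heisenberg design itself
(HeisenbergThresholdDesigns) is kept as the rank-2 crux.
Lean: `(∀ d : ℕ, 3 ≤ d → ∃ b : ℝ, 0 < b ∧ ∃ C : ℝ, ∀ (s : ℕ) (X Y Z : Finset
(Matrix.SpecialLinearGroup (Fin d) ℤ)), (∀ g ∈ X ∪ Y ∪ Z, ∀ i j : Fin d, j ≤ i → (g : Matrix (Fin d)
(Fin d) ℤ) i j = if i = j then 1 else 0) → (∀ x ∈ X, ∀ x' ∈ X, ∀ y ∈ Y, ∀ y' ∈ Y, ∀ z ∈ Z, ∀ z' ∈ Z,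
x * y⁻¹ * y' * z⁻¹ = x' * z'⁻¹ → x = x' ∧ y = y' ∧ z = z') → (∀ x₀ ∈ X, ∀ z₀ ∈ Z, ∃ p : MvPolynomial
(Fin d × Fin d) ℂ, MvPolynomial.weightedTotalDegree (fun ij : Fin d × Fin d => (ij.2 : ℕ) - ij.1) p
≤ s ∧ ∀ x ∈ X, ∀ y ∈ Y, ∀ y' ∈ Y, ∀ z ∈ Z, MvPolynomial.eval (fun ij : Fin d × Fin d => (((x * y⁻¹ *
y' * z⁻¹ : Matrix.SpecialLinearGroup (Fin d) ℤ) : Matrix (Fin d) (Fin d) ℤ) ij.1 ij.2 : ℂ)) p = if x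
= x₀ ∧ y = y' ∧ z = z₀ then 1 else 0) → ((X.card : ℝ) * Y.card * Z.card) ^
(Literature.Computability.AlgebraicComplexity.omega ℂ / 3) ≤ C * ((s : ℝ) + 1) ^ (((d : ℝ) * (d - 1)
/ 2 - b) / 2 * Literature.Computability.AlgebraicComplexity.omega ℂ + b)) ∧ (∃ d : ℕ, 3 ≤ d ∧ ∀ δ :
ℝ, 0 < δ → ∀ s₀ : ℕ, ∃ s : ℕ, s₀ ≤ s ∧ ∃ X Y Z : Finset (Matrix.SpecialLinearGroup (Fin d) ℤ), (∀ g
∈ X ∪ Y ∪ Z, ∀ i j : Fin d, j ≤ i → (g : Matrix (Fin d) (Fin d) ℤ) i j = if i = j then 1 else 0) ∧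
(∀ x ∈ X, ∀ x' ∈ X, ∀ y ∈ Y, ∀ y' ∈ Y, ∀ z ∈ Z, ∀ z' ∈ Z, x * y⁻¹ * y' * z⁻¹ = x' * z'⁻¹ → x = x' ∧
y = y' ∧ z = z') ∧ (∀ x₀ ∈ X, ∀ z₀ ∈ Z, ∃ p : MvPolynomial (Fin d × Fin d) ℂ,
MvPolynomial.weightedTotalDegree (fun ij : Fin d × Fin d => (ij.2 : ℕ) - ij.1) p ≤ s ∧ ∀ x ∈ X, ∀ y
∈ Y, ∀ y' ∈ Y, ∀ z ∈ Z, MvPolynomial.eval (fun ij : Fin d × Fin d => (((x * y⁻¹ * y' * z⁻¹ :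
Matrix.SpecialLinearGroup (Fin d) ℤ) : Matrix (Fin d) (Fin d) ℤ) ij.1 ij.2 : ℂ)) p = if x = x₀ ∧ y =
y' ∧ z = z₀ then 1 else 0) ∧ (s : ℝ) ^ ((3 : ℝ) / 4 * d * (d - 1) - δ) ≤ (X.card : ℝ) * Y.card *
Z.card)`

## Assembly
Exponent bookkeeping over ℝ, no analysis beyond logarithms: from UnitriangularCostShape at the d
supplied by NilpotentThresholdDesigns take
b > 0 and C; designs with |X||Y||Z| ≥ s^((3/2)D − δ) give s^(((3/2)D − δ)ω/3) ≤ C (s+1)^(((D−b)/2)ω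
+ b), i.e. b(ω − 2)/2 ≤ δω/3 + O(1/log s);
s is unbounded and δ arbitrary, so ω ≤ 2, and ω ≥ 2 is the tree's
Literature.Computability.AlgebraicComplexity.omega_two_le; hence
ω(ℂ) = 2 = Summit.MatrixMultiplication (MatrixMultiplication_iff). The Heisenberg branch
(HeisenbergBranch) is the same computation with
d = 3, b = 1 and needs only the provable HeisenbergEnvelopingCost.

Rationale: WHY THIS LINE. BlasiakCohnGrochowPrattUmans2024 (arXiv:2410.14905) Thm 2.2 turns a TPP triple in an
INFINITE group plus separating functions drawn from a
finite-dimensional representation into (|X||Y||Z|)^(ω/3) ≤ Σ (dim ρ)^ω, instantiate it only in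
GL_n/U_n (missing ω = 2 by Θ(n) dimensions,
Thm C / §4), list nilpotent and solvable Lie groups and 'a single fixed infinite group' as
unexplored (p. 4, §4), and leave Remark 2.4
(price = rank of multiplication in the IMAGE ALGEBRA ρ(ℂ[G]), not (dim ρ)^ω) unused; CohnUmans2003
§7 Prop 13 / Cor 14 already has a
Heisenberg Lie TPP (three n-dimensional subgroups of H_(2n+1)(ℝ), Lie pseudo-exponent 2 + 1/n) with
no algorithm attached. In a unipotent
host every irreducible constituent is 1-dimensional, so Thm 2.2 is empty and Remark 2.4 is
everything: the image algebra of polynomials of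
weighted degree ≤ s is a quotient of U(u_d)/I^(s+1), and for H_3 a faithful truncated
Schrödinger–Fock module (X ↦ z∂_t, Y ↦ t, Z ↦ z on
ℂ[z,t]/(weight ≥ 2s+1)) embeds it into M_(2s+1)(ℂ[z]/z^(s+1)), so the price is ≤ (2s+1)^ω (s+1) —
the Wedderburn shape q^2·1 + (q−1)·q^ω of
the finite Heisenberg group with the degree budget in the role of the modulus (cost ancestry:
multiplication of linear differential
operators is exponent-equivalent to matrix multiplication, doi:10.1006/jsco.2000.0496,
doi:10.1109/FOCS.2012.57, arXiv:0804.2181). Imported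
areas: Lie theory / enveloping algebras and the orbit method (cost side, Dixmier1977), polynomial
interpolation on lattice designs
(design side), asymptotic-spectrum calculus (assembly; tree: asymptoticRank, structureTensor,
omega_two_le). What no prior route does:
GroupTheoreticSTPP is finite abelian STPP (its header defers 'the continuous Lie-group analogue …
own interface'); ModularHeisenberg uses
𝔽_p[H_p] as a border-rank carrier with no TPP design; OrbitHarmonicsHosts hosts in commutative
graded quotients ℂ[x]/LF(I(P)); here the
host is non-commutative U(u_d)/I^(s+1), the design lives in a torsion-free nilpotent group, and the
threshold is exactly half dimension
with no amortisation by rank (BCGPU's Θ(n)-deficit escape is unavailable, so the design crux is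
sharp). Negatives index: empty.

RANKED CRUXES. #0 NilpotentThresholdDesigns (target) — DESIGN half of X: for some d ≥ 3, every δ > 0
and every s₀ there are s ≥ s₀ and finite X, Y, Z ⊂ U_d(ℤ) (upper unitriangular elements of SL(d,ℤ))
with the TPP in embedding form, separating polynomials of (j−i)-weighted degree ≤ s for every target
x₀ z₀⁻¹ (BCGPU24 Def 2.1 on X Y⁻¹ Y Z⁻¹), and |X||Y||Z| ≥ s^((3/4)d(d−1) − δ). (why it might fail:
Half dimension is the flattening ceiling (|X||Z| ≤ dim Pol_≤s ~ s^D): designs must saturate it up to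
s^o(1); CU03 Cor 14's Heisenberg triple sits 3/2 below, BCGPU's GL_n/U_n designs Θ(n) below, and
invariant (Lemma 2.11) schemes look capped 1/2 short in 2-step hosts.)
[BlasiakCohnGrochowPrattUmans2024, CohnUmans2003, BlasiakCohnGrochowPrattUmans2023]
#2 HeisenbergThresholdDesigns (crux) — the d = 3 (Heisenberg H_3(ℤ)) case of the target: for every δ
> 0 and s₀, some s ≥ s₀ admits TPP sets X, Y, Z ⊂ U_3(ℤ) with weighted-degree-≤-s separating
polynomials (weights 1,1,2 on x₁₂, x₂₃, x₁₃) and |X||Y||Z| ≥ s^(9/2 − δ) — a 'single fixed infinite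
group' construction (BCGPU24 §4, third bullet); by HeisenbergBranch it alone gives ω = 2.
[difficulty: open-problem] (why it might fail: Known H_3 designs reach s^3 (CU03 Cor 14 with Y =
exp(t(X+Y)): invariant e₁₃−e₁₂e₂₃ = −Δ²/2, degree 4q) and thickened-Lagrangian invariant schemes
seem capped at s^4 (card C3); s^(4.3) would already beat ω < 2.371, so the last s^(1/2) is as hard
as ω itself.) [CohnUmans2003, BlasiakCohnGrochowPrattUmans2024, Murthy2026]
#3 HeisenbergEnvelopingCost (crux) — card (1a) made end-to-end: there is C such that for every s and
every TPP triple X, Y, Z ⊂ U_3(ℤ) with weighted-degree-≤-s separating polynomials, (|X||Y||Z|)^(ω/3)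
≤ C (s+1)^(ω+1). Proof plan: separating polynomials are matrix coefficients of the faithful
truncated module W = ℂ[z,t]/(wt ≥ 2s+1) of U(h_3)/I^(2s+1) (Ann ⊂ I^(s+1), U–Pol pairing, Taylor),
so ⟨|X|,|Y|,|Z|⟩ restricts to the structure tensor of ρ(ℂ[H]) ⊂ End_R(W), R = ℂ[z]/z^(s+1); lift to
M_(2s+1)(R); HostingBound; R̃(⟨N,N,N⟩ ⊠ T_R) ≤ N^ω (s+1), C = 2^ω ≤ 8. [deps: HostingBound]
[difficulty: L] (why it might fail: Unpublished (card + planner derivation): if RepFun(W_(2s+1))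
missed part of Pol_≤s, or the lift End_R(W) → M_N(R) cost an extra factor s^c, the exponent ω+1
would move and with it the half-dimension threshold the design cruxes aim at.)
[BlasiakCohnGrochowPrattUmans2024, doi:10.1109/FOCS.2012.57, doi:10.1006/jsco.2000.0496,
BurgisserClausenShokrollahi1997, Blaser2013]
#4 HeisenbergThresholdObstruction (crux) — NEGATIVE side, staffed: a power saving in the Heisenberg
host — there are c > 0 and C such that every TPP triple in U_3(ℤ) with weighted-degree-≤-s
separating polynomials has |X||Y||Z| ≤ C (s+1)^(9/2 − c). The trivial bound is C s^(9/2) (flattening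
ranks of the hosting); any c > 0 refutes HeisenbergThresholdDesigns (ObstructionKillsHeisenberg) and
is the 2-step no-go of the card as a theorem about ALL schemes, not only invariant ones.
[difficulty: L] (why it might fail: False if ω = 2 is witnessed in H_3; and no tool in print saves a
power for char-0 polynomial interpolation on TPP configurations — slice rank needs bounded exponent
(BCCGU17 Ex 3.15 kills UT_m(𝔽_p), p fixed, not U_3(ℤ)), BCGPU23 Thm 3.2/4.7 need Lie type or
subvarieties.) [BlasiakChurchCohnGrochowUmans2017, BlasiakCohnGrochowPrattUmans2023, Murthy2026,
BlasiakCohnGrochowPrattUmans2024]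
#5 UnitriangularCostShape (crux) — card C2 (cost numerology of the tower): for every d ≥ 3 there are
b > 0 and C with (|X||Y||Z|)^(ω/3) ≤ C (s+1)^(((D−b)/2)·ω + b), D = d(d−1)/2, for every TPP triple
in U_d(ℤ) with weighted-degree-≤-s separating polynomials — i.e. R̃ of the image algebra of
U(u_d)/I^(s+1) is priced like Σ_χ χ(1)^ω over Irr(U_d(𝔽_q)) with q ~ s; expected b = ⌊d/2⌋ = index
of u_d (number of generic coadjoint-orbit parameters), via a faithful truncated module free over the
Casimir subalgebra (Gelfand–Kirillov: Frac U(u_d) ≅ Frac A_a ⊗ ℂ(z_1..z_b), 2a + b = D). d = 3 is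
HeisenbergEnvelopingCost. [deps: HeisenbergEnvelopingCost] [difficulty: XL] (why it might fail:
Gelfand–Kirillov is birational: a polynomial (unlocalised) Weyl-type model of U(u_d)/I^(s+1) free
over the Casimirs may not exist for d ≥ 4, and a torsion defect of size s^c in the centre directions
breaks 2a + b = D, pushing the threshold above the reachable half dimension.) [Dixmier1977,
BlasiakCohnGrochowPrattUmans2024, CohnUmans2003, doi:10.1109/FOCS.2012.57]
#6 HigherStepThresholdDesigns (crux) — card C1 (the relocated design crux): for some d ≥ 4 (step d−1
≥ 3; first candidate U_4, dim 6, weights 1,1,1,2,2,3) the target holds: TPP triples in U_d(ℤ) with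
weighted-degree-≤-s separating polynomials and |X||Y||Z| ≥ s^((3/4)d(d−1) − δ) for every δ > 0 and
unboundedly many s. Rationale: for step ≥ 3 the double-coset space X\G/Z available to invariant
separating polynomials (BCGPU24 Lemma 2.11) is no longer one-dimensional as it is for complementary
Lagrangians in H_(2n+1). [deps: UnitriangularCostShape] [difficulty: open-problem] (why it might
fail: dim(X\G/Z) generically equals the total deficit of X and Z below half dimension, so invariant
schemes may be forced to deficit ≥ c(d) > 0 in every nilpotent host (card C3(ii)); non-invariant
separation at degree q^(1+o(1)) is uncharted.) [BlasiakCohnGrochowPrattUmans2024, CohnUmans2003,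
BlasiakCohnGrochowPrattUmans2023]
#9 HostingBound (support) — the abstract core of CU03 Thm 4.1 / BCGPU24 Thm 2.2 + Rem 2.4: if
ℂ-linear maps α : ℂ^(n×m) → A, β : ℂ^(m×p) → A, γ : A → ℂ^(n×p) into a ℂ-algebra A with a finite
basis b satisfy γ(α(M)·β(N)) = M·N, then (nmp)^(ω/3) ≤ R̃(structureTensor b) (restriction ⟨n,m,p⟩ ≤
T_A, cyclic symmetrisation ⟨n,m,p⟩⊗⟨m,p,n⟩⊗⟨p,n,m⟩ = ⟨nmp,nmp,nmp⟩, R̃ submultiplicative and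
monotone, R̃(⟨q,q,q⟩) = q^ω in tree). [difficulty: M] [CohnUmans2003,
BlasiakCohnGrochowPrattUmans2024, Strassen1988, BurgisserClausenShokrollahi1997]
#9 HeisenbergBranch (support) — the Heisenberg branch closes the summit by itself:
HeisenbergEnvelopingCost → HeisenbergThresholdDesigns → ω(ℂ) = 2 (exponent bookkeeping:
s^((9/2−δ)ω/3) ≤ C (s+1)^(ω+1) for unbounded s forces (ω−2)/2 ≤ δω/3, all δ > 0; with omega_two_le).
[difficulty: provable-now] [Blaser2013, BlasiakCohnGrochowPrattUmans2024]
#9 ObstructionKillsHeisenberg (support) — HeisenbergThresholdObstruction → ¬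
HeisenbergThresholdDesigns (take δ = c/2 and s large against C). [difficulty: provable-now]
[BlasiakCohnGrochowPrattUmans2024]
#9 DesignsGiveTarget (support) — either design crux instantiates the target (d := 3, using (3/4)·3·2
= 9/2; or the d ≥ 4 witness). [difficulty: provable-now] [BlasiakCohnGrochowPrattUmans2024]

TWO-LAYER PLAN. HeisenbergEnvelopingCost ⇐ SeparatingPolynomialsAreCoefficients (Pol_≤s ⊆
RepFun(W_(2s+1)), faithfulness of U(h_3)_≤s on W) →
HeisenbergHosting (hosting identity γ(α(M)β(N)) = MN in M_(2s+1)(ℂ[z]/z^(s+1)) from TPP +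
separation) → TruncatedMatrixAlgebraCost
(R̃(⟨N,N,N⟩ ⊠ T_(ℂ[z]/z^m)) ≤ N^ω m, Bini for ℂ[z]/z^m) → HeisenbergEnvelopingCost.
UnitriangularCostShape ⇐ d = 3 (HeisenbergEnvelopingCost) →
d = 4 (explicit faithful module over ℂ[z₁,z₂], b = 2) → general d. HeisenbergThresholdObstruction ⇐
invariant-scheme cap (card C3(i): Y with
|⟨Da,Db⟩| ≤ q^(1+o(1)) and q-separated c-fibres has |Y| ≤ q^(1+o(1))) → general schemes; or ⇐ an
asymptotic-subrank deficit
Q̃(T_(U(h_3)/I^(s+1))) ≤ s^(3−c), which kills the host outright. HeisenbergThresholdDesigns ⇐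
(thickened Lagrangian X, Z) → (design of Y) once a scheme is proposed.

KILL CRITERIA. HeisenbergThresholdObstruction proved ⇒ HeisenbergThresholdDesigns refuted (drop the
Heisenberg branch, keep d ≥ 4). A proof that for
every d ≥ 3 TPP + degree-s separation forces |X||Y||Z| ≤ C_d s^((3/2)D − c_d) (the obstruction for
the whole tower) refutes
NilpotentThresholdDesigns: close `refuted:NilpotentThresholdDesigns`. UnitriangularCostShape refuted
at some d (R̃ of U(u_d)/I^(s+1)
≥ s^((D/2)ω − o(1)) relative to designs, or 2a + b > D forced) removes that d only — pivot to the d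
where it holds (d = 3 is safe once
HeisenbergEnvelopingCost lands). HeisenbergEnvelopingCost refuted (exponent > ω + 1) ⇒ re-derive the
threshold; if the corrected threshold
exceeds the flattening ceiling s^(9/2), close the Heisenberg branch. ω = 2 proved elsewhere moots
the route; a proof of ω > 2 refutes every design crux via the cost items.

NOT DECOMPOSED YET. The Heisenberg family H_(2n+1)(ℤ), n ≥ 2 (inside U_(n+2) with weights 1,1,2;
cost exponent nω + 1, threshold 3n + 3/2) is not typed at
open — same mechanism, no amortisation in n, add by `workitem add` if a design scheme wants n ≥ 2.
The value of b for d ≥ 4 (expected ⌊d/2⌋),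
the border-rank (Thm 2.6) variant with 1-parameter families, real/complex (non-integer) design
points, and the card's C3(ii) 'deficit =
dim X\G/Z' meta-statement are deliberately left informal. No definition requests: everything is
stated over Mathlib's SpecialLinearGroup,
MvPolynomial.weightedTotalDegree and the tree's omega / asymptoticRank / structureTensor.

CHEAPEST FALSIFIER. A kit search the card already names (C4): in U_3(ℤ) with entries in boxes of
side ≤ 30, maximise |X||Y||Z| over TPP triples admitting
weighted-degree-s separation (separation is a linear feasibility / rank test on the evaluation
matrix of weighted monomials on X Y⁻¹ Y Z⁻¹:
rank ev_Q = rank ev_(Q∖{t}) + 1 for each target t), and plot log|X||Y||Z| / log s: a curve pinned at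
≤ 4 supports HeisenbergThresholdObstruction,
points drifting above 4 would be the first non-invariant designs. Second cheapest: compute
R̃-proxies (border rank upper bounds by explicit
degenerations) of U(u_4)/I^(s+1) for s ≤ 6 to test b = 2 in UnitriangularCostShape. Neither was run
here (planner seat, gate/compute not used).

NUMBERS. Threshold exponent (3/2)D: d = 3: 9/2; d = 4: 9; d = 5: 15. Heisenberg cost:
(|X||Y||Z|)^(ω/3) ≤ (2s+1)^ω (s+1) ≤ 2^ω (s+1)^(ω+1) ≤ 8 (s+1)^(ω+1) (N = 2s+1
summands, m = s+1). Known designs: CU03 Cor 14 in H_(2n+1): |X||Y||Z| = q^(3n), separating degree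
O(q) for n = 1 (planner check), i.e. exponent 3 of
the needed 9/2; BCGPU24 Thm C in U_n: size q^(n²/2 − Θ(n)) per set at degree O(q). Current ω <
2.371339 (AlmanEtAl2024); a Heisenberg design
with exponent e gives ω ≤ 3/(e − 3), so e > 4.27 already improves the record. Finite shadow: Σ_χ
χ(1)^ω over Irr(H_3(𝔽_q)) = q² + (q−1)q^ω;
over Irr(U_4(𝔽_q)) the top degree is q² with ~q² such characters (b = 2). Items at open: 11 (1
target, 5 cruxes, 4 support, 1 assembly).

DEFINITION REQUESTS. None at open. (If H_(2n+1) or general Carnot-graded nilpotent hosts are typed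
later: a `WeightedPolynomialGroupLaw` interface on ℤ^D with a
separate construction statement — posited object, not smuggled.)

Novelty: Searches (2026-08-15): `lit read arxiv:2410.14905 --grep separat|Remark 2.4|Theorem 2.2|Definition
2.1` (pp. 10–19, 34 read: nilpotent/solvable
listed open p. 4; Rem 2.4 unused p. 13; §4 bullets); `lit read arxiv:math/0307321 --grep
pseudo-exponent` (CU03 §7 Prop 13 / Cor 14 / Cor 15 read);
`lit search --source zbmath "triple product property matrix multiplication group"` (phrase-quoted)
(7: Neumann 2011, Hedtke–Murthy, BCGPU ITCS 2025 — none
nilpotent-Lie); `lit search --source zbmath "triple product property Heisenberg group"` (4,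
irrelevant); `lit search --source zbmath "skew
polynomials fast multiplication"` (van der Hoeven 2002 found) and "Cohn Umans nilpotent" (1:
arXiv:1712.02302); `lit citing arxiv:2410.14905`
(2 citers: arXiv:2411.15789 + 1 unresolved, neither on new hosts); `lit frontier
MatrixMultiplication --since 2022` (30 rows, none on Lie hosts);
`lit bridges MatrixMultiplication --cross any`; `lit galaxy search "triple product property" --star
pdf` (6: Sawin, CKSU05, BCGPU ITCS25,
Stothers) and three further galaxy phrases (0 hits); `lit search --hybrid` local (books only);
OpenAlex/S2/arXiv APIs rate-limited (429) at
filing; ledger negatives (0); the 150-card idea list of the sub (Heisenberg appears in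
heisenberg-stpp-superabelian-blocks,
modular-heisenberg-transfer, qutrit-heisenberg-trace-cube,
symplectic-sqrt-cancellation-modulation-nogo — none uses Lie hosts or enveloping algebras).
Nearest prior art found: BlasiakCohnGrochowPrattUmans2024 = arXiv:2410.14  [refs: 10.1109/FOCS.2012.57, 10.1006/jsco.2000.0496, 2410.14905, math/0307321, 1712.02302, 2411.15789, 0804.2181, 2602.15796, arxiv:2410.14905, arxiv:math/0307321, doi:10.1109/FOCS.2012.57, doi:10.1006/jsco.2000.0496, BlasiakCohnGrochowPrattUmans2024, CohnUmans2003, Murthy2026]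

Barriers (technique_class: group-theoretic-approach, structure-tensor-of-algebra): - technique_class: group-theoretic-approach, structure-tensor-of-algebra
- Literature.Barriers.MatrixMultiplication.NilpotentGroupBarrier: outside its class — it kills
STPP/TPP via the CKSU inequality in finite nilpotent groups of BOUNDED exponent (Jennings-degree
slice rank; UT_m(𝔽_p), p fixed, Ex 3.15); U_d(ℤ) is torsion-free, its finite shadows U_d(ℤ/Nℤ) have
exponent → ∞, and the route never uses Irr(G) or 𝔽_p[G] but the degree-budgeted RepFun; the bet is
that char-0 polynomial interpolation has no slice-rank analogue (HeisenbergThresholdObstruction is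
filed to test exactly this).
- Literature.Barriers.MatrixMultiplication.QuasirandomBarrier: BCGPU23 Thm 3.2 needs finite
(quasi)simple Lie type and Thm 4.7 needs subvarieties over an algebraically closed field; designs
here are finite integer point sets in a unipotent group whose ambient modulus is decoupled from the
cost scale s (card point (2)); n/a, recorded because its evasions_known ('Lie exponent as
intermediate target') is this route's starting point.
- Literature.Barriers.MatrixMultiplication.UnstableTensorBarrier: the structure tensor of
U(u_d)/I^(s+1) IS unstable (local algebra; already ℂ[z]/z^m lies in the null cone) and the route
needs these tensors to be asymptotically reversible up to s^o(1) (designs at half dimension ⇔ hosted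
volume ≈ R̃^(3/2)); Bläser–Lysikov Thm 16/17 bound the irreversibility of a FIXED unstable tensor
below by a format-dependent B(n) > 1 (minuscule, scope caveat (c)), whereas we take ONE

Novelty grade: new-combination — route-review (refuter rreview-c9821b09): NEW-COMBINATION as claimed (BCGPU24 Rem 2.4 pricing × CU03 Heisenberg Lie TPP × Weyl-type cost of differential-operator multiplication); grade rests on the planner's documented searches — searchd was unavailable (rc 75 ×2) at review time, a novelty-audit seat (refuter refuter-rreview-route-AtomisticToContinu-c9821b09-0, 2026-08-15T14:00:46Z; prior: arXiv:2410.14905 (BlasiakCohnGrochowPrattUmans2024) Thm 2.2 / Rem 2.4 (image-algebra pricing, stated but unused; nilpotent hosts listed open), CohnUmans2003 §7 Prop 13 / Cor 14 (Heisenberg Lie TPP, pseudo-exponent 2+1/n, no algorithm), doi:10.1006/jsco.2000.0496 + doi:10.1109/FOCS.2012.57 (differential-operator multiplication ≍ MM: the un-truncated Weyl shadow of the cost bound), Murthy2026 arXiv:)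

History (route lifecycle, newest last):
- 2026-08-16T04:11:03Z · AUTO-CRUX (backfill): NilpotentThresholdDesigns — hypotheses of the deciding theorem that nothing in the route derives are cruxes (operator:999:1085951)
- 2026-08-24T07:49:38Z · DORMANT — reconciler: no traction for 6.6 d (last activity item-evidence-added at 2026-08-17T16:51:17Z); parked, not closed — `ledger route dormant route-MatrixMultiplica (operator:999:1998177)

sub-problem: MatrixMultiplication · status: dormant · opened planner-plancard-MatrixMultiplication-MatrixM-1e66b272-0 2026-08-15T12:17:06Z · rev 1 · ledger route-MatrixMultiplication-NilpotentLieHosts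
GENERATED by the gate from the ledger (D-0016/17). Provers cite these decls: `theorem foo : Summit.MatrixMultiplication.MatrixMultiplication.Theses.NilpotentLieHosts.<Decl> := …` in Summits/MatrixMultiplication/MatrixMultiplication/Theorems/<Name>.lean.
-/

namespace Summit.MatrixMultiplication.MatrixMultiplication.Theses.NilpotentLieHosts

open scoped BigOperators Topology Manifold Classical MeasureTheory ProbabilityTheory Matrix InnerProductSpace ComplexConjugate ContinuousMap
open Filter Set Function TopologicalSpace MeasureTheory

attribute [summit_statement] _root_.MatrixMultiplication

/-- item stmt-MatrixMultiplication-7720 · crux (kind.auto-crux: conjecture-grade) · rank 0 · open · by planner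
why it might fail: Half dimension is the flattening ceiling (|X||Z| ≤ dim Pol_≤s ~ s^D): designs must saturate it up to s^o(1); CU03 Cor 14's Heisenberg triple sits 3/2 below, BCGPU's GL_n/U_n designs Θ(n) below, and invariant (Lemma 2.11) schemes look capped 1/2 short in 2-step hosts.
sources: BlasiakCohnGrochowPrattUmans2024, CohnUmans2003, BlasiakCohnGrochowPrattUmans2023
[target] DESIGN half of X: for some d ≥ 3, every δ > 0 and every s₀ there are s ≥ s₀ and finite X,
Y, Z ⊂ U_d(ℤ) (upper unitriangular elements of SL(d,ℤ)) with the TPP in embedding form, separating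
polynomials of (j−i)-weighted degree ≤ s for every target x₀ z₀⁻¹ (BCGPU24 Def 2.1 on X Y⁻¹ Y Z⁻¹),
and |X||Y||Z| ≥ s^((3/4)d(d−1) − δ). -/
@[route_item "route-MatrixMultiplication-NilpotentLieHosts", crux]
def NilpotentThresholdDesigns : Prop :=
  ∃ d : ℕ, 3 ≤ d ∧ ∀ δ : ℝ, 0 < δ → ∀ s₀ : ℕ, ∃ s : ℕ, s₀ ≤ s ∧ ∃ X Y Z : Finset (Matrix.SpecialLinearGroup (Fin d) ℤ), (∀ g ∈ X ∪ Y ∪ Z, ∀ i j : Fin d, j ≤ i → (g : Matrix (Fin d) (Fin d) ℤ) i j = if i = j then 1 else 0) ∧ (∀ x ∈ X, ∀ x' ∈ X, ∀ y ∈ Y, ∀ y' ∈ Y, ∀ z ∈ Z, ∀ z' ∈ Z, x * y⁻¹ * y' * z⁻¹ = x' * z'⁻¹ → x = x' ∧ y = y' ∧ z = z') ∧ (∀ x₀ ∈ X, ∀ z₀ ∈ Z, ∃ p : MvPolynomial (Fin d × Fin d) ℂ, MvPolynomial.weightedTotalDegree (fun ij : Fin d × Fin d => (ij.2 : ℕ)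 - ij.1) p ≤ s ∧ ∀ x ∈ X, ∀ y ∈ Y, ∀ y' ∈ Y, ∀ z ∈ Z, MvPolynomial.eval (fun ij : Fin d × Fin d => (((x * y⁻¹ * y' * z⁻¹ : Matrix.SpecialLinearGroup (Fin d) ℤ) : Matrix (Fin d) (Fin d) ℤ) ij.1 ij.2 : ℂ)) p = if x = x₀ ∧ y = y' ∧ z = z₀ then 1 else 0) ∧ (s : ℝ) ^ ((3 : ℝ) / 4 * d * (d - 1) - δ) ≤ (X.card : ℝ) * Y.card * Z.card

/-- item stmt-MatrixMultiplication-7721 · crux · rank 2 · open · by planner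
why it might fail: Known H_3 designs reach s^3 (CU03 Cor 14 with Y = exp(t(X+Y)): invariant e₁₃−e₁₂e₂₃ = −Δ²/2, degree 4q) and thickened-Lagrangian invariant schemes seem capped at s^4 (card C3); s^(4.3) would already beat ω < 2.371, so the last s^(1/2) is as hard as ω itself.
sources: CohnUmans2003, BlasiakCohnGrochowPrattUmans2024, Murthy2026
[crux] the d = 3 (Heisenberg H_3(ℤ)) case of the target: for every δ > 0 and s₀, some s ≥ s₀ admits
TPP sets X, Y, Z ⊂ U_3(ℤ) with weighted-degree-≤-s separating polynomials (weights 1,1,2 on x₁₂,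
x₂₃, x₁₃) and |X||Y||Z| ≥ s^(9/2 − δ) — a 'single fixed infinite group' construction (BCGPU24 §4,
third bullet); by HeisenbergBranch it alone gives ω = 2. [difficulty: open-problem] -/
@[route_item "route-MatrixMultiplication-NilpotentLieHosts"]
def HeisenbergThresholdDesigns : Prop :=
  ∀ δ : ℝ, 0 < δ → ∀ s₀ : ℕ, ∃ s : ℕ, s₀ ≤ s ∧ ∃ X Y Z : Finset (Matrix.SpecialLinearGroup (Fin 3) ℤ), (∀ g ∈ X ∪ Y ∪ Z, ∀ i j : Fin 3, j ≤ i → (g : Matrix (Fin 3) (Fin 3) ℤ) i j = if i = j then 1 else 0) ∧ (∀ x ∈ X, ∀ x' ∈ X, ∀ y ∈ Y, ∀ y' ∈ Y, ∀ z ∈ Z, ∀ z' ∈ Z, x * y⁻¹ * y' * z⁻¹ = x' * z'⁻¹ → x = x' ∧ y = y' ∧ z = z') ∧ (∀ x₀ ∈ X, ∀ z₀ ∈ Z, ∃ p : MvPolynomial (Fin 3 × Fin 3) ℂ, MvPolynomial.weightedTotalDegree (fun ij : Fin 3 × Fin 3 => (ij.2 : ℕ) - ij.1) p ≤ s ∧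 ∀ x ∈ X, ∀ y ∈ Y, ∀ y' ∈ Y, ∀ z ∈ Z, MvPolynomial.eval (fun ij : Fin 3 × Fin 3 => (((x * y⁻¹ * y' * z⁻¹ : Matrix.SpecialLinearGroup (Fin 3) ℤ) : Matrix (Fin 3) (Fin 3) ℤ) ij.1 ij.2 : ℂ)) p = if x = x₀ ∧ y = y' ∧ z = z₀ then 1 else 0) ∧ (s : ℝ) ^ ((9 : ℝ) / 2 - δ) ≤ (X.card : ℝ) * Y.card * Z.card

/-- item stmt-MatrixMultiplication-7722 · crux · rank 3 · closed · proved by Summit.MatrixMultiplication.MatrixMultiplication.Theorems.heisenbergEnvelopingCost_proof @ 2612df622ac4 (prover) · by planner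
why it might fail: Unpublished (card + planner derivation): if RepFun(W_(2s+1)) missed part of Pol_≤s, or the lift End_R(W) → M_N(R) cost an extra factor s^c, the exponent ω+1 would move and with it the half-dimension threshold the design cruxes aim at.
sources: BlasiakCohnGrochowPrattUmans2024, doi:10.1109/FOCS.2012.57, doi:10.1006/jsco.2000.0496, BurgisserClausenShokrollahi1997, Blaser2013
[crux] card (1a) made end-to-end: there is C such that for every s and every TPP triple X, Y, Z ⊂
U_3(ℤ) with weighted-degree-≤-s separating polynomials, (|X||Y||Z|)^(ω/3) ≤ C (s+1)^(ω+1). Proof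
plan: separating polynomials are matrix coefficients of the faithful truncated module W = ℂ[z,t]/(wt
≥ 2s+1) of U(h_3)/I^(2s+1) (Ann ⊂ I^(s+1), U–Pol pairing, Taylor), so ⟨|X|,|Y|,|Z|⟩ restricts to the
structure tensor of ρ(ℂ[H]) ⊂ End_R(W), R = ℂ[z]/z^(s+1); lift to M_(2s+1)(R); HostingBound;
R̃(⟨N,N,N⟩ ⊠ T_R) ≤ N^ω (s+1), C = 2^ω ≤ 8. [deps: HostingBound] [difficulty: L] -/
@[route_item "route-MatrixMultiplication-NilpotentLieHosts"]
def HeisenbergEnvelopingCost : Prop :=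
  ∃ C : ℝ, ∀ (s : ℕ) (X Y Z : Finset (Matrix.SpecialLinearGroup (Fin 3) ℤ)), (∀ g ∈ X ∪ Y ∪ Z, ∀ i j : Fin 3, j ≤ i → (g : Matrix (Fin 3) (Fin 3) ℤ) i j = if i = j then 1 else 0) → (∀ x ∈ X, ∀ x' ∈ X, ∀ y ∈ Y, ∀ y' ∈ Y, ∀ z ∈ Z, ∀ z' ∈ Z, x * y⁻¹ * y' * z⁻¹ = x' * z'⁻¹ → x = x' ∧ y = y' ∧ z = z') → (∀ x₀ ∈ X, ∀ z₀ ∈ Z, ∃ p : MvPolynomial (Fin 3 × Fin 3) ℂ, MvPolynomial.weightedTotalDegree (fun ij : Fin 3 × Fin 3 => (ij.2 : ℕ) - ij.1) p ≤ s ∧ ∀ x ∈ X, ∀ y ∈ Y, ∀ y' ∈ Y, ∀ z ∈ Z, MvPolynomial.eval (fun ij : Fin 3 × Fin 3 => (((x * y⁻¹ * y' * z⁻¹ : Matrix.SpecialLinearGroup (Fin 3) ℤ) : Matrix (Fin 3) (Fin 3) ℤ) ij.1 ij.2 : ℂ)) p = if x = x₀ ∧ y = y' ∧ z = z₀ then 1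 else 0) → ((X.card : ℝ) * Y.card * Z.card) ^ (Literature.Computability.AlgebraicComplexity.omega ℂ / 3) ≤ C * ((s : ℝ) + 1) ^ (Literature.Computability.AlgebraicComplexity.omega ℂ + 1)

/-- item stmt-MatrixMultiplication-7723 · crux · rank 4 · open · by planner
why it might fail: False if ω = 2 is witnessed in H_3; and no tool in print saves a power for char-0 polynomial interpolation on TPP configurations — slice rank needs bounded exponent (BCCGU17 Ex 3.15 kills UT_m(𝔽_p), p fixed, not U_3(ℤ)), BCGPU23 Thm 3.2/4.7 need Lie type or subvarieties.
sources: BlasiakChurchCohnGrochowUmans2017, BlasiakCohnGrochowPrattUmans2023, Murthy2026, BlasiakCohnGrochowPrattUmans2024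
[crux] NEGATIVE side, staffed: a power saving in the Heisenberg host — there are c > 0 and C such
that every TPP triple in U_3(ℤ) with weighted-degree-≤-s separating polynomials has |X||Y||Z| ≤ C
(s+1)^(9/2 − c). The trivial bound is C s^(9/2) (flattening ranks of the hosting); any c > 0 refutes
HeisenbergThresholdDesigns (ObstructionKillsHeisenberg) and is the 2-step no-go of the card as a
theorem about ALL schemes, not only invariant ones. [difficulty: L] -/
@[route_item "route-MatrixMultiplication-NilpotentLieHosts"]
def HeisenbergThresholdObstruction : Prop :=
  ∃ c : ℝ, 0 < c ∧ ∃ C : ℝ, ∀ (s : ℕ) (X Y Z : Finset (Matrix.SpecialLinearGroup (Fin 3) ℤ)), (∀ g ∈ X ∪ Y ∪ Z, ∀ i j : Fin 3, j ≤ i → (g : Matrix (Fin 3) (Fin 3) ℤ) i j = if i = j then 1 else 0) → (∀ x ∈ X, ∀ x' ∈ X, ∀ y ∈ Y, ∀ y' ∈ Y, ∀ z ∈ Z, ∀ z' ∈ Z, x * y⁻¹ * y' * z⁻¹ = x' * z'⁻¹ → x = x' ∧ y = y' ∧ z = z') → (∀ x₀ ∈ X, ∀ z₀ ∈ Z, ∃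 p : MvPolynomial (Fin 3 × Fin 3) ℂ, MvPolynomial.weightedTotalDegree (fun ij : Fin 3 × Fin 3 => (ij.2 : ℕ) - ij.1) p ≤ s ∧ ∀ x ∈ X, ∀ y ∈ Y, ∀ y' ∈ Y, ∀ z ∈ Z, MvPolynomial.eval (fun ij : Fin 3 × Fin 3 => (((x * y⁻¹ * y' * z⁻¹ : Matrix.SpecialLinearGroup (Fin 3) ℤ) : Matrix (Fin 3) (Fin 3) ℤ) ij.1 ij.2 : ℂ)) p = if x = x₀ ∧ y = y' ∧ z = z₀ then 1 else 0) → (X.card : ℝ) * Y.card * Z.card ≤ C * ((s : ℝ) + 1) ^ ((9 : ℝ) / 2 - c)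

/-- item stmt-MatrixMultiplication-7724 · crux · rank 5 · closed · proved by Summit.MatrixMultiplication.MatrixMultiplication.Theorems.unitriangularCostShape_proof @ 6c9811b94df7 (prover) · by planner
why it might fail: Gelfand–Kirillov is birational: a polynomial (unlocalised) Weyl-type model of U(u_d)/I^(s+1) free over the Casimirs may not exist for d ≥ 4, and a torsion defect of size s^c in the centre directions breaks 2a + b = D, pushing the threshold above the reachable half dimension.
sources: Dixmier1977, BlasiakCohnGrochowPrattUmans2024, CohnUmans2003, doi:10.1109/FOCS.2012.57
[crux] card C2 (cost numerology of the tower): for every d ≥ 3 there are b > 0 and C with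
(|X||Y||Z|)^(ω/3) ≤ C (s+1)^(((D−b)/2)·ω + b), D = d(d−1)/2, for every TPP triple in U_d(ℤ) with
weighted-degree-≤-s separating polynomials — i.e. R̃ of the image algebra of U(u_d)/I^(s+1) is
priced like Σ_χ χ(1)^ω over Irr(U_d(𝔽_q)) with q ~ s; expected b = ⌊d/2⌋ = index of u_d (number of
generic coadjoint-orbit parameters), via a faithful truncated module free over the Casimir
subalgebra (Gelfand–Kirillov: Frac U(u_d) ≅ Frac A_a ⊗ ℂ(z_1..z_b), 2a + b = D). d = 3 is
HeisenbergEnvelopingCost. [deps: HeisenbergEnvelopingCost] [difficulty: XL] -/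
@[route_item "route-MatrixMultiplication-NilpotentLieHosts", crux]
def UnitriangularCostShape : Prop :=
  ∀ d : ℕ, 3 ≤ d → ∃ b : ℝ, 0 < b ∧ ∃ C : ℝ, ∀ (s : ℕ) (X Y Z : Finset (Matrix.SpecialLinearGroup (Fin d) ℤ)), (∀ g ∈ X ∪ Y ∪ Z, ∀ i j : Fin d, j ≤ i → (g : Matrix (Fin d) (Fin d) ℤ) i j = if i = j then 1 else 0) → (∀ x ∈ X, ∀ x' ∈ X, ∀ y ∈ Y, ∀ y' ∈ Y, ∀ z ∈ Z, ∀ z' ∈ Z, x * y⁻¹ * y' * z⁻¹ = x' * z'⁻¹ → x = x' ∧ y = y' ∧ z = z') → (∀ x₀ ∈ X, ∀ z₀ ∈ Z, ∃ p : MvPolynomial (Fin d × Fin d) ℂ, MvPolynomial.weightedTotalDegree (fun ij : Fin d × Fin d => (ij.2 : ℕ) - ij.1) p ≤ s ∧ ∀ x ∈ X, ∀ y ∈ Y, ∀ y' ∈ Y, ∀ z ∈ Z, MvPolynomial.eval (fun ij : Fin d × Fin d => (((x * y⁻¹ * y' * z⁻¹ : Matrix.SpecialLinearGroup (Fin d)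 ℤ) : Matrix (Fin d) (Fin d) ℤ) ij.1 ij.2 : ℂ)) p = if x = x₀ ∧ y = y' ∧ z = z₀ then 1 else 0) → ((X.card : ℝ) * Y.card * Z.card) ^ (Literature.Computability.AlgebraicComplexity.omega ℂ / 3) ≤ C * ((s : ℝ) + 1) ^ (((d : ℝ) * (d - 1) / 2 - b) / 2 * Literature.Computability.AlgebraicComplexity.omega ℂ + b)

/-- item stmt-MatrixMultiplication-7725 · crux · rank 6 · open · by planner
why it might fail: dim(X\G/Z) generically equals the total deficit of X and Z below half dimension, so invariant schemes may be forced to deficit ≥ c(d) > 0 in every nilpotent host (card C3(ii)); non-invariant separation at degree q^(1+o(1)) is uncharted.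
sources: BlasiakCohnGrochowPrattUmans2024, CohnUmans2003, BlasiakCohnGrochowPrattUmans2023
[crux] card C1 (the relocated design crux): for some d ≥ 4 (step d−1 ≥ 3; first candidate U_4, dim
6, weights 1,1,1,2,2,3) the target holds: TPP triples in U_d(ℤ) with weighted-degree-≤-s separating
polynomials and |X||Y||Z| ≥ s^((3/4)d(d−1) − δ) for every δ > 0 and unboundedly many s. Rationale:
for step ≥ 3 the double-coset space X\G/Z available to invariant separating polynomials (BCGPU24
Lemma 2.11) is no longer one-dimensional as it is for complementary Lagrangians in H_(2n+1). [deps: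
UnitriangularCostShape] [difficulty: open-problem] -/
@[route_item "route-MatrixMultiplication-NilpotentLieHosts"]
def HigherStepThresholdDesigns : Prop :=
  ∃ d : ℕ, 4 ≤ d ∧ ∀ δ : ℝ, 0 < δ → ∀ s₀ : ℕ, ∃ s : ℕ, s₀ ≤ s ∧ ∃ X Y Z : Finset (Matrix.SpecialLinearGroup (Fin d) ℤ), (∀ g ∈ X ∪ Y ∪ Z, ∀ i j : Fin d, j ≤ i → (g : Matrix (Fin d) (Fin d) ℤ) i j = if i = j then 1 else 0) ∧ (∀ x ∈ X, ∀ x' ∈ X, ∀ y ∈ Y, ∀ y' ∈ Y, ∀ z ∈ Z, ∀ z' ∈ Z, x * y⁻¹ * y' * z⁻¹ = x' * z'⁻¹ → x = x' ∧ y = y' ∧ z = z') ∧ (∀ x₀ ∈ X, ∀ z₀ ∈ Z, ∃ p : MvPolynomial (Fin d × Fin d) ℂ, MvPolynomial.weightedTotalDegree (fun ij : Fin d × Fin d => (ij.2 : ℕ) - ij.1) p ≤ s ∧ ∀ x ∈ X, ∀ y ∈ Y, ∀ y' ∈ Y, ∀ z ∈ Z, MvPolynomial.eval (fun ij : Fin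 d × Fin d => (((x * y⁻¹ * y' * z⁻¹ : Matrix.SpecialLinearGroup (Fin d) ℤ) : Matrix (Fin d) (Fin d) ℤ) ij.1 ij.2 : ℂ)) p = if x = x₀ ∧ y = y' ∧ z = z₀ then 1 else 0) ∧ (s : ℝ) ^ ((3 : ℝ) / 4 * d * (d - 1) - δ) ≤ (X.card : ℝ) * Y.card * Z.card

/-- item stmt-MatrixMultiplication-7726 · support · rank 9 · closed · proved by Summit.MatrixMultiplication.MatrixMultiplication.Theorems.hostingBound_proof (prover) · by planner
sources: CohnUmans2003, BlasiakCohnGrochowPrattUmans2024, Strassen1988, BurgisserClausenShokrollahi1997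
[support] the abstract core of CU03 Thm 4.1 / BCGPU24 Thm 2.2 + Rem 2.4: if ℂ-linear maps α :
ℂ^(n×m) → A, β : ℂ^(m×p) → A, γ : A → ℂ^(n×p) into a ℂ-algebra A with a finite basis b satisfy
γ(α(M)·β(N)) = M·N, then (nmp)^(ω/3) ≤ R̃(structureTensor b) (restriction ⟨n,m,p⟩ ≤ T_A, cyclic
symmetrisation ⟨n,m,p⟩⊗⟨m,p,n⟩⊗⟨p,n,m⟩ = ⟨nmp,nmp,nmp⟩, R̃ submultiplicative and monotone,
R̃(⟨q,q,q⟩) = q^ω in tree). [difficulty: M] -/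
@[route_item "route-MatrixMultiplication-NilpotentLieHosts"]
def HostingBound : Prop :=
  ∀ (A : Type) [Ring A] [Algebra ℂ A] (ι : Type) [Fintype ι] (b : Module.Basis ι ℂ A) (n m p : ℕ) (α : Matrix (Fin n) (Fin m) ℂ →ₗ[ℂ] A) (β : Matrix (Fin m) (Fin p) ℂ →ₗ[ℂ] A) (γ : A →ₗ[ℂ] Matrix (Fin n) (Fin p) ℂ), (∀ M N, γ (α M * β N) = M * N) → ((n * m * p : ℕ) : ℝ) ^ (Literature.Computability.AlgebraicComplexity.omega ℂ / 3) ≤ Literature.Computability.AlgebraicComplexity.asymptoticRank (Literature.Computability.AlgebraicComplexity.structureTensor b)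

/-- item stmt-MatrixMultiplication-7727 · support · rank 9 · closed · proved by Summit.MatrixMultiplication.MatrixMultiplication.Theorems.heisenbergBranch_proof @ 46997ff96d8d (prover) · by planner
sources: Blaser2013, BlasiakCohnGrochowPrattUmans2024
[support] the Heisenberg branch closes the summit by itself: HeisenbergEnvelopingCost →
HeisenbergThresholdDesigns → ω(ℂ) = 2 (exponent bookkeeping: s^((9/2−δ)ω/3) ≤ C (s+1)^(ω+1) for
unbounded s forces (ω−2)/2 ≤ δω/3, all δ > 0; with omega_two_le). [difficulty: provable-now] -/
@[route_item "route-MatrixMultiplication-NilpotentLieHosts"]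
def HeisenbergBranch : Prop :=
  HeisenbergEnvelopingCost → HeisenbergThresholdDesigns → MatrixMultiplication

/-- item stmt-MatrixMultiplication-7728 · support · rank 9 · closed · proved by Summit.MatrixMultiplication.MatrixMultiplication.Theorems.obstructionKillsHeisenberg_proof @ ba317947dfd2 (prover) · by planner
sources: BlasiakCohnGrochowPrattUmans2024
[support] HeisenbergThresholdObstruction → ¬ HeisenbergThresholdDesigns (take δ = c/2 and s large
against C). [difficulty: provable-now] -/
@[route_item "route-MatrixMultiplication-NilpotentLieHosts"]
def ObstructionKillsHeisenberg : Prop :=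
  HeisenbergThresholdObstruction → ¬ HeisenbergThresholdDesigns

/-- item stmt-MatrixMultiplication-7729 · support · rank 9 · closed · proved by Summit.MatrixMultiplication.MatrixMultiplication.Theorems.designsGiveTarget_proof @ e6edc0185a25 (prover) · by planner
sources: BlasiakCohnGrochowPrattUmans2024
[support] either design crux instantiates the target (d := 3, using (3/4)·3·2 = 9/2; or the d ≥ 4
witness). [difficulty: provable-now] -/
@[route_item "route-MatrixMultiplication-NilpotentLieHosts"]
def DesignsGiveTarget : Prop :=
  (HeisenbergThresholdDesigns ∨ HigherStepThresholdDesigns) → NilpotentThresholdDesigns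

/-- item stmt-MatrixMultiplication-7730 · assembly · rank 1 · closed · proved by Summit.MatrixMultiplication.MatrixMultiplication.Theorems.nilpotentLieHosts_assembly_proof @ 54df80d7053a (prover) · by planner
sources: Blaser2013, BlasiakCohnGrochowPrattUmans2024
[assembly] UnitriangularCostShape → NilpotentThresholdDesigns → MatrixMultiplication (ω(ℂ) = 2). -/
@[route_item "route-MatrixMultiplication-NilpotentLieHosts"]
def Assembly : Prop :=
  UnitriangularCostShape → NilpotentThresholdDesigns → MatrixMultiplication

/-! D-0027 §2.1 — DECIDING THEOREM (planner-authored via `route open/edit --closes-file`; by planner-rbadge-MatrixMultiplication-NilpotentL-c1f880ef-g2-0 2026-08-15T16:18:24Z):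
its hypotheses are this route's items and its conclusion the sub-problem Statement (glue_lint), and it elaborates with this file. -/

/-- DECIDING THEOREM (D-0027 §2.1): COST ∧ DESIGN decide `ω(ℂ) = 2` — this is exactly the route's
`Assembly` (`UnitriangularCostShape → NilpotentThresholdDesigns → MatrixMultiplication`), proved.
`2 ≤ ω` is the tree's flattening bound `omega_two_le`. For `ω ≤ 2` argue by contradiction: if
`2 < ω`, take the design dimension `d ≥ 3` of `NilpotentThresholdDesigns` and the cost shape `b > 0`,
`C` of `UnitriangularCostShape` at that `d`; feed the design half the loss `δ := b(ω-2)/(2ω) > 0`.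
Then the design exponent times `ω/3` exceeds the cost exponent `F := ((d(d-1)/2 - b)/2)·ω + b` by
exactly `g := b(ω-2)/3 > 0` (both carry `d(d-1)ω/4`), so a design at budget `s ≥ 1` gives
`s^g · s^F = s^(g+F) ≤ (|X||Y||Z|)^(ω/3) ≤ C·(s+1)^F ≤ max C 1 · max 1 2^F · s^F`, i.e.
`s^g ≤ max C 1 · max 1 2^F`, impossible for the unboundedly large budgets `s` the design half supplies
(`tendsto_rpow_atTop`). The Heisenberg branch (`HeisenbergBranch`: d = 3, b = 1, exponent ω+1,
threshold 9/2) is the same bookkeeping and stays a provable-now support item. -/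
@[closes "route-MatrixMultiplication-NilpotentLieHosts"] theorem closes (hCost : UnitriangularCostShape) (hDesign : NilpotentThresholdDesigns) :
    MatrixMultiplication := by
  show Literature.Computability.AlgebraicComplexity.omega ℂ = 2
  have hw2 : 2 ≤ Literature.Computability.AlgebraicComplexity.omega ℂ :=
    Literature.Computability.AlgebraicComplexity.omega_two_le ℂ
  refine le_antisymm ?_ hw2
  refine not_lt.1 fun hlt => ?_
  set w : ℝ := Literature.Computability.AlgebraicComplexity.omega ℂ with hwdef
  -- the design dimension `d` and the cost shape `b`, `C` at that dimension
  obtain ⟨d, hd3, hD⟩ := hDesign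
  obtain ⟨b, hb, C, hC⟩ := hCost d hd3
  have hwpos : 0 < w := lt_of_lt_of_le two_pos hw2
  have hw2' : 0 < w - 2 := sub_pos.2 hlt
  -- the loss `δ = b(w-2)/(2w)` fed to the design half, the cost exponent `F`, the gap `g`
  have hδ : 0 < b * (w - 2) / (2 * w) := div_pos (mul_pos hb hw2') (mul_pos two_pos hwpos)
  set F : ℝ := ((d : ℝ) * (d - 1) / 2 - b) / 2 * w + b with hFdef
  set g : ℝ := b * (w - 2) / 3 with hgdef
  have hg : 0 < g := div_pos (mul_pos hb hw2') three_pos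
  have hcancel : b * (w - 2) / (2 * w) * (w / 3) = b * (w - 2) / 6 := by
    field_simp
    ring
  have hexp : ((3 : ℝ) / 4 * d * (d - 1) - b * (w - 2) / (2 * w)) * (w / 3) = g + F := by
    rw [sub_mul, hcancel, hgdef, hFdef]
    ring
  -- constants: `C' = max C 1` and `K = max 1 2^F` with `(s+1)^F ≤ K·s^F` for `s ≥ 1`
  set C' : ℝ := max C 1 with hC'def
  set K : ℝ := max 1 ((2 : ℝ) ^ F) with hKdef
  have hC'1 : 1 ≤ C' := le_max_right _ _
  have hK1 : 1 ≤ K := le_max_left _ _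
  have hC'0 : 0 ≤ C' := zero_le_one.trans hC'1
  -- `x ↦ x^g` is unbounded: beyond `M` it exceeds `C'·K + 1`
  obtain ⟨M, hM⟩ := Filter.tendsto_atTop_atTop.1 (tendsto_rpow_atTop hg) (C' * K + 1)
  -- a design at a budget `s ≥ max 1 ⌈M⌉₊`, and its price
  obtain ⟨s, hs, X, Y, Z, hU, hT, hS, hV⟩ := hD (b * (w - 2) / (2 * w)) hδ (max 1 (Nat.ceil M))
  have hs1 : 1 ≤ s := (le_max_left _ _).trans hs
  have hsM : M ≤ (s : ℝ) :=
    (Nat.le_ceil M).trans (by exact_mod_cast (le_max_right 1 (Nat.ceil M)).trans hs)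
  have hsR1 : (1 : ℝ) ≤ s := by exact_mod_cast hs1
  have hsR0 : (0 : ℝ) < s := one_pos.trans_le hsR1
  have hcost := hC s X Y Z hU hT hS
  -- real bookkeeping
  have hV0 : (0 : ℝ) ≤ (X.card : ℝ) * Y.card * Z.card := by positivity
  have hsF : (0 : ℝ) < (s : ℝ) ^ F := Real.rpow_pos_of_pos hsR0 F
  have h1 : (s : ℝ) ^ g * (s : ℝ) ^ F ≤ ((X.card : ℝ) * Y.card * Z.card) ^ (w / 3) := by
    rw [← Real.rpow_add hsR0, ← hexp, Real.rpow_mul hsR0.le]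
    exact Real.rpow_le_rpow (Real.rpow_nonneg hsR0.le _) hV (div_nonneg hwpos.le three_pos.le)
  have h2 : C * ((s : ℝ) + 1) ^ F ≤ C' * (K * (s : ℝ) ^ F) := by
    have hs1F : (0 : ℝ) ≤ ((s : ℝ) + 1) ^ F := Real.rpow_nonneg (by positivity) F
    have h3 : ((s : ℝ) + 1) ^ F ≤ K * (s : ℝ) ^ F := by
      rcases le_or_gt 0 F with hF | hF
      · calc ((s : ℝ) + 1) ^ F ≤ (2 * (s : ℝ)) ^ F :=
              Real.rpow_le_rpow (by positivity) (by linarith) hF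
          _ = (2 : ℝ) ^ F * (s : ℝ) ^ F := Real.mul_rpow zero_le_two hsR0.le
          _ ≤ K * (s : ℝ) ^ F := mul_le_mul_of_nonneg_right (le_max_right _ _) hsF.le
      · calc ((s : ℝ) + 1) ^ F ≤ (s : ℝ) ^ F :=
              Real.rpow_le_rpow_of_nonpos hsR0 (by linarith) hF.le
          _ = 1 * (s : ℝ) ^ F := (one_mul _).symm
          _ ≤ K * (s : ℝ) ^ F := mul_le_mul_of_nonneg_right hK1 hsF.le
    calc C * ((s : ℝ) + 1) ^ F ≤ C' * ((s : ℝ) + 1) ^ F :=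
          mul_le_mul_of_nonneg_right (le_max_left _ _) hs1F
      _ ≤ C' * (K * (s : ℝ) ^ F) := mul_le_mul_of_nonneg_left h3 hC'0
  have h4 : (s : ℝ) ^ g * (s : ℝ) ^ F ≤ C' * K * (s : ℝ) ^ F := by
    rw [mul_assoc]
    exact h1.trans (hcost.trans h2)
  have h5 : (s : ℝ) ^ g ≤ C' * K := le_of_mul_le_mul_right h4 hsF
  have h6 : C' * K + 1 ≤ (s : ℝ) ^ g := hM (s : ℝ) hsM
  linarith

end Summit.MatrixMultiplication.MatrixMultiplication.Theses.NilpotentLieHosts
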